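import Mathlib

/-!
# No primitive class of positive even degree in a connected graded bialgebra with bounded grading (char 0)

The «power argument» of Mumford's proof that the cohomology ring of an abelian variety has no primitive elements
in positive even degree [cite: MumfordAV1970, §13 Cor. 2 (p. 129)], i.e. the characteristic-`0` half of the
Milnor–Moore ∕ Hopf–Borel structure theory in its most elementary instance
[cite: MilnorMoore1965, §4 Prop. 4.17 (p. 231)]:
let `H 0, H 1, H 2, …` be the EVEN-degree pieces `Ȟ²ⁱ(A)` of a graded-commutative `k`-algebra (so that they
commute honestly), `S i = Ȟ²ⁱ(A × A)`, `m : H i → S i` the comultiplication (pull-back along the group law), and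
`κ : H a ⊗ H b → S (a+b)`, `x ⊗ y ↦ p₁^*x ∪ p₂^*y` the Künneth pairing.  If `m` is multiplicative, `κ` is multiplicative
(`κ(y ⊗ z) ∪ κ(y' ⊗ z') = κ(yy' ⊗ zz')` — this is where graded commutativity of `Ȟ(A × A)` enters), `κ` is injective on
`⊕_{a+b=n} H a ⊗ H b` (Künneth), the grading is bounded (`H N = 0` for some `N`) and `char k = 0`, then every
PRIMITIVE `x ∈ H 1` (`m x = κ(x ⊗ 1) + κ(1 ⊗ x)`) is zero: with `n ≥ 1` minimal such that `xⁿ = 0`, expanding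
`0 = m(xⁿ) = m(x)ⁿ = Σ_{i+j=n} C(n,i) κ(xⁱ ⊗ xʲ)` and projecting to the component `H 1 ⊗ H (n-1)` gives
`n · (x ⊗ xⁿ⁻¹) = 0`, whence `x = 0` or `xⁿ⁻¹ = 0` — both absurd.

Everything is stated for graded PIECES (`H S : ℕ → Type`) with products `cupH a b n (h : a + b = n)` carrying their
target degree as data, and binomial sums indexed by `Finset.antidiagonal n`, so that no transport along `a + b = b + a`
or `n + 1 - (i + 1) = n - i` is ever needed; the powers `xp i = xⁱ` are an input sequence characterised by `xp 0 = 1`,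
`xp (i+1) = xp i ∪ x`.  Pure linear algebra; the geometric instantiation (ordered Čech cohomology of an abelian scheme
over a field, multiplicativity of `m^*, p₁^*, p₂^*`, Künneth injectivity, the diagonal trick for graded
commutativity) is done elsewhere.
-/

namespace Literature.Algebra.Bialgebra

open TensorProduct Finset

universe u v w

section Pieces

variable {k : Type u} [Field k]
  {H : ℕ → Type v} [∀ i, AddCommGroup (H i)] [∀ i, Module k (H i)]
  {S : ℕ → Type w} [∀ i, AddCommGroup (S i)] [∀ i, Module k (S i)]
  (cupH : ∀ a b n : ℕ, a + b = n → H a →ₗ[k] H b →ₗ[k] H n)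
  (cupS : ∀ a b n : ℕ, a + b = n → S a →ₗ[k] S b →ₗ[k] S n)
  (κ : ∀ a b n : ℕ, a + b = n → H a →ₗ[k] H b →ₗ[k] S n)
  (m : ∀ n : ℕ, H n →ₗ[k] S n) (one : H 0)

/-- **Binomial expansion of the coproduct of a power of a primitive.**  If `m` is multiplicative, the Künneth
pairing `κ` is multiplicative and `1` is a right unit, then for a primitive `x ∈ H 1` (`m x = κ(x ⊗ 1) + κ(1 ⊗ x)`),
`m 1 = κ(1 ⊗ 1)`, and its powers `xp i = xⁱ` (`xp 0 = 1`, `xp (i+1) = xp i ∪ x`):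
`m(xⁿ) = Σ_{(i,j), i+j=n} C(n,i) · κ(xⁱ ⊗ xʲ)` (the summand is extended by `0` off the antidiagonal so that it is a
total function of `(i,j)`). [cite: MumfordAV1970, §13 Cor. 2 (p. 129), proof]
[cite: MilnorMoore1965, §4 Prop. 4.17 (p. 231)] -/
theorem map_pow_eq_sum_antidiagonal
    (hm_mul : ∀ (a b n : ℕ) (h : a + b = n) (y : H a) (z : H b),
      m n (cupH a b n h y z) = cupS a b n h (m a y) (m b z))
    (hκ_mul : ∀ (a b n : ℕ) (h : a + b = n) (a' b' n' : ℕ) (h' : a' + b' = n') (N : ℕ) (hN : n + n' = N)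
      (A : ℕ) (hA : a + a' = A) (B : ℕ) (hB : b + b' = B) (y : H a) (z : H b) (y' : H a') (z' : H b'),
      cupS n n' N hN (κ a b n h y z) (κ a' b' n' h' y' z') =
        κ A B N (by omega) (cupH a a' A hA y y') (cupH b b' B hB z z'))
    (hone_right : ∀ (a : ℕ) (y : H a), cupH a 0 a (by omega) y one = y)
    (hm_one : m 0 one = κ 0 0 0 rfl one one)
    {x : H 1} (hx : m 1 x = κ 1 0 1 rfl x one + κ 0 1 1 rfl one x)
    (xp : ∀ i, H i) (hxp0 : xp 0 = one) (hxps : ∀ i, xp (i + 1) = cupH i 1 (i + 1) rfl (xp i) x) (n : ℕ) :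
    m n (xp n) = ∑ p ∈ antidiagonal n,
      (if h : p.1 + p.2 = n then (n.choose p.1 : k) • κ p.1 p.2 n h (xp p.1) (xp p.2) else (0 : S n)) := by
  induction n with
  | zero =>
    have h00 : ((0 : ℕ), (0 : ℕ)).1 + ((0 : ℕ), (0 : ℕ)).2 = 0 := rfl
    rw [Finset.Nat.antidiagonal_zero, Finset.sum_singleton, dif_pos h00, hxp0, hm_one]
    simp
  | succ n ih =>
    -- `m(xⁿ⁺¹) = m(xⁿ) ∪ m(x) = (Σ C(n,i) κ(xⁱ ⊗ xʲ)) ∪ (κ(x ⊗ 1) + κ(1 ⊗ x))`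
    rw [hxps n, hm_mul, ih, hx, map_sum, LinearMap.sum_apply]
    simp_rw [map_add]
    rw [Finset.sum_add_distrib]
    -- the two families, re-expressed through `K q = κ(x^{q.1} ⊗ x^{q.2}) ∈ S (n+1)`
    set K : ℕ × ℕ → S (n + 1) := fun q =>
      if h : q.1 + q.2 = n + 1 then κ q.1 q.2 (n + 1) h (xp q.1) (xp q.2) else 0 with hK
    have h1 : ∀ p ∈ antidiagonal n,
        cupS n 1 (n + 1) rfl
          (if h : p.1 + p.2 = n then (n.choose p.1 : k) • κ p.1 p.2 n h (xp p.1) (xp p.2) else (0 : S n))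
          (κ 1 0 1 rfl x one) = (n.choose p.1 : k) • K (p.1 + 1, p.2) := by
      intro p hp
      have hpn : p.1 + p.2 = n := Finset.HasAntidiagonal.mem_antidiagonal.mp hp
      rw [dif_pos hpn, map_smul, LinearMap.smul_apply,
        hκ_mul p.1 p.2 n hpn 1 0 1 rfl (n + 1) rfl (p.1 + 1) rfl p.2 (by omega), hone_right, ← hxps p.1, hK]
      simp only
      rw [dif_pos (by omega)]
    have h2 : ∀ p ∈ antidiagonal n,
        cupS n 1 (n + 1) rfl
          (if h : p.1 + p.2 = n then (n.choose p.1 : k) • κ p.1 p.2 n h (xp p.1) (xp p.2) else (0 : S n))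
          (κ 0 1 1 rfl one x) = (n.choose p.1 : k) • K (p.1, p.2 + 1) := by
      intro p hp
      have hpn : p.1 + p.2 = n := Finset.HasAntidiagonal.mem_antidiagonal.mp hp
      rw [dif_pos hpn, map_smul, LinearMap.smul_apply,
        hκ_mul p.1 p.2 n hpn 0 1 1 rfl (n + 1) rfl p.1 rfl (p.2 + 1) rfl, hone_right, ← hxps p.2, hK]
      simp only
      rw [dif_pos (by omega)]
    rw [Finset.sum_congr rfl h1, Finset.sum_congr rfl h2]
    -- the target, re-expressed through `K`
    have h3 : ∀ q ∈ antidiagonal (n + 1),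
        (if h : q.1 + q.2 = n + 1 then ((n + 1).choose q.1 : k) • κ q.1 q.2 (n + 1) h (xp q.1) (xp q.2)
          else (0 : S (n + 1))) = ((n + 1).choose q.1 : k) • K q := by
      intro q hq
      have hqn : q.1 + q.2 = n + 1 := Finset.HasAntidiagonal.mem_antidiagonal.mp hq
      rw [dif_pos hqn, hK]
      simp only
      rw [dif_pos hqn]
    rw [Finset.sum_congr rfl h3]
    -- Pascal: `Σ_{q} C(n+1,q.1) K q = K(0,n+1) + Σ_{(i,j)} (C(n,i) + C(n,i+1)) K(i+1,j)`
    rw [Finset.Nat.sum_antidiagonal_succ (f := fun q => ((n + 1).choose q.1 : k) • K q)]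
    simp only [Nat.choose_zero_right, Nat.cast_one, one_smul]
    simp_rw [Nat.choose_succ_succ', Nat.cast_add, add_smul]
    rw [Finset.sum_add_distrib]
    -- the second family: `Σ_{(i,j)} C(n,i) K(i,j+1) = Σ_q C(n,q.1) K q = K(0,n+1) + Σ_{(i,j)} C(n,i+1) K(i+1,j)`
    have h4 : ∑ p ∈ antidiagonal n, (n.choose p.1 : k) • K (p.1, p.2 + 1) =
        K (0, n + 1) + ∑ p ∈ antidiagonal n, (n.choose (p.1 + 1) : k) • K (p.1 + 1, p.2) := by
      have e1 := Finset.Nat.sum_antidiagonal_succ (n := n) (f := fun q => (n.choose q.1 : k) • K q)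
      have e2 := Finset.Nat.sum_antidiagonal_succ' (n := n) (f := fun q => (n.choose q.1 : k) • K q)
      simp only [Nat.choose_zero_right, Nat.cast_one, one_smul, Nat.choose_succ_self, Nat.cast_zero,
        zero_smul, zero_add] at e1 e2
      rw [← e2, e1]
    rw [h4]
    abel

/-- **Non-degeneracy of pure tensors over a field**: `y ⊗ z = 0` forces `y = 0` or `z = 0` (test against
`φ ⊗ ψ` for linear forms with `φ y = ψ z = 1`). [cite: MumfordAV1970, §13 Cor. 2 (p. 129), proof] -/
theorem eq_zero_or_eq_zero_of_tmul_eq_zero {V : Type v} {W : Type w} [AddCommGroup V] [Module k V]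
    [AddCommGroup W] [Module k W] {y : V} {z : W} (h : y ⊗ₜ[k] z = 0) : y = 0 ∨ z = 0 := by
  by_cases hy : y = 0
  · exact Or.inl hy
  by_cases hz : z = 0
  · exact Or.inr hz
  exfalso
  obtain ⟨φ, hφ⟩ := Module.Projective.exists_dual_eq_one k hy
  obtain ⟨ψ, hψ⟩ := Module.Projective.exists_dual_eq_one k hz
  have := congrArg (fun t => TensorProduct.lid k k (TensorProduct.map φ ψ t)) h
  simp only [TensorProduct.map_tmul, TensorProduct.lid_tmul, hφ, hψ, smul_eq_mul, mul_one, map_zero] at this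
  exact one_ne_zero this

/-- **No primitive element of degree `2` (power argument, char `0`).**  In the setting of
`map_pow_eq_sum_antidiagonal` (pieces `H i = Ȟ²ⁱ(A)`, `S i = Ȟ²ⁱ(A × A)`, multiplicative coproduct `m`, multiplicative
unital Künneth pairing `κ`), assume moreover that `κ` is injective on `⊕_{i+j=n} H i ⊗ H j` for every `n` (Künneth)
and that the grading is bounded (`H N = 0` for some `N`).  Then over a field of characteristic `0` every primitive
`x ∈ H 1`, `m x = κ(x ⊗ 1) + κ(1 ⊗ x)`, vanishes.  (Take `n ≥ 1` least with `xⁿ = 0`; the `(1, n-1)` Künneth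
component of `0 = m(xⁿ) = Σ C(n,i) κ(xⁱ ⊗ xʲ)` is `n · x ⊗ xⁿ⁻¹ = 0`.)
[cite: MumfordAV1970, §13 Cor. 2 (p. 129)] [cite: MilnorMoore1965, §4 Prop. 4.17 (p. 231)] -/
theorem eq_zero_of_primitive_of_bounded [CharZero k]
    (hm_mul : ∀ (a b n : ℕ) (h : a + b = n) (y : H a) (z : H b),
      m n (cupH a b n h y z) = cupS a b n h (m a y) (m b z))
    (hκ_mul : ∀ (a b n : ℕ) (h : a + b = n) (a' b' n' : ℕ) (h' : a' + b' = n') (N : ℕ) (hN : n + n' = N)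
      (A : ℕ) (hA : a + a' = A) (B : ℕ) (hB : b + b' = B) (y : H a) (z : H b) (y' : H a') (z' : H b'),
      cupS n n' N hN (κ a b n h y z) (κ a' b' n' h' y' z') =
        κ A B N (by omega) (cupH a a' A hA y y') (cupH b b' B hB z z'))
    (hone_left : ∀ (a : ℕ) (y : H a), cupH 0 a a (by omega) one y = y)
    (hone_right : ∀ (a : ℕ) (y : H a), cupH a 0 a (by omega) y one = y)
    (hm_one : m 0 one = κ 0 0 0 rfl one one)
    (hκ_inj : ∀ (n : ℕ) (t : ∀ p : ℕ × ℕ, H p.1 ⊗[k] H p.2),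
      (∑ p ∈ antidiagonal n,
        (if h : p.1 + p.2 = n then TensorProduct.lift (κ p.1 p.2 n h) (t p) else (0 : S n))) = 0 →
      ∀ p ∈ antidiagonal n, t p = 0)
    (hnil : ∃ N : ℕ, ∀ y : H N, y = 0)
    {x : H 1} (hx : m 1 x = κ 1 0 1 rfl x one + κ 0 1 1 rfl one x) : x = 0 := by
  classical
  -- the powers `xⁱ ∈ H i`
  let xp : ∀ i, H i := fun i => Nat.rec (motive := fun i => H i) one (fun i y => cupH i 1 (i + 1) rfl y x) i
  have hxp0 : xp 0 = one := rfl
  have hxps : ∀ i, xp (i + 1) = cupH i 1 (i + 1) rfl (xp i) x := fun i => rfl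
  have hxp1 : xp 1 = x := by
    change cupH 0 1 (0 + 1) rfl (xp 0) x = x
    rw [hxp0]
    exact hone_left 1 x
  -- least `n` with `xⁿ = 0`
  obtain ⟨N, hN⟩ := hnil
  have hex : ∃ n, xp n = 0 := ⟨N, hN _⟩
  set n := Nat.find hex with hn
  have hn0 : xp n = 0 := Nat.find_spec hex
  have hmin : ∀ i < n, xp i ≠ 0 := fun i hi => Nat.find_min hex hi
  by_contra hx0
  -- `n ≥ 2`: `x⁰ = 1 ≠ 0` (else `x = 1 ∪ x = 0`) and `x¹ = x ≠ 0`
  have hn2 : 2 ≤ n := by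
    by_contra hlt
    have h01 : n = 0 ∨ n = 1 := by omega
    rcases h01 with h | h
    · -- `x⁰ = 1 = 0`, hence `x = 1 ∪ x = 0`
      have h0 : one = 0 := by
        have := hn0
        rw [h] at this
        exact this
      exact hx0 (by rw [← hone_left 1 x, h0, LinearMap.map_zero₂])
    · have h1 : xp 1 = 0 := by
        have := hn0
        rw [h] at this
        exact this
      exact hx0 (hxp1 ▸ h1)
  -- `0 = m(xⁿ) = Σ C(n,i) κ(xⁱ ⊗ xʲ)`: every Künneth component `C(n,i) · xⁱ ⊗ xʲ` vanishes
  have hsum := map_pow_eq_sum_antidiagonal cupH cupS κ m one hm_mul hκ_mul hone_right hm_one hx xp hxp0 hxps n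
  rw [hn0, map_zero] at hsum
  have hcomp := hκ_inj n (fun p => (n.choose p.1 : k) • (xp p.1 ⊗ₜ[k] xp p.2)) (by
    rw [hsum]
    refine Finset.sum_congr rfl fun p hp => ?_
    have hpn : p.1 + p.2 = n := Finset.HasAntidiagonal.mem_antidiagonal.mp hp
    rw [dif_pos hpn, dif_pos hpn, map_smul, TensorProduct.lift.tmul])
  -- the `(1, n-1)` component: `n · (x ⊗ xⁿ⁻¹) = 0`
  have h1n := hcomp (1, n - 1) (Finset.HasAntidiagonal.mem_antidiagonal.mpr (by simp only; omega))
  simp only [Nat.choose_one_right] at h1n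
  rw [smul_eq_zero] at h1n
  rcases h1n with h | h
  · exact (Nat.cast_ne_zero.mpr (by omega : n ≠ 0)) h
  · rcases eq_zero_or_eq_zero_of_tmul_eq_zero h with h' | h'
    · exact hx0 (hxp1 ▸ h')
    · exact hmin (n - 1) (by omega) h'

end Pieces

end Literature.Algebra.Bialgebra
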